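import Literature.AlgebraicGeometry.HodgeTheory.NodalPencilPicardLefschetz
import HarnessLib

/-!
# The one-node Picard–Lefschetz fact keyed to MONOMIAL pencil directions — and its proof

Family `hodge`, layer `Literature/AlgebraicGeometry/HodgeTheory`; sequel of `PicardLefschetzNodalFormsKeyed` (prover seat
`hodge-nonav-19716-p2` g10: the named facts `picardLefschetz_oneNode`, `picardLefschetz_exchangedPair` of crux K1-B
`VeryGeneralSignCommutatorsInHg`, route `HodgeConjecture/SignSymmetricPowers`, stmt-HodgeConjecture-19716). Written by the prover seat
`hodge-nonav-prover-Bx` (g15, cell `hodge-nonav`). The telescope of K1-B consumes `picardLefschetz_oneNode` only for pencil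
directions which are MONOMIALS up to a scalar (`x₄^d`, `x₀^d`, `(ψ/2)·x_j^d`; route owner's ruling STATUS 2026-08-28T22:46:09Z), and for
these the ODP-ISOTOPY port proves it (`NodalPencilPicardLefschetz.picardLefschetz_oneNode_monomial`). This file records the keyed
statement as a `Prop` next to its siblings, PROVES it, and records the implication from the general-direction fact:

* `picardLefschetz_oneNodeMonomial` — `picardLefschetz_oneNode` VERBATIM with the direction specialised to `g := a • X i ^ d`
  (for every `i : Fin (n + 2)` and `a : ℂ` with `(a • X i ^ d)(p) ≠ 0`, i.e. `a ≠ 0`, `pᵢ ≠ 0`);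
* `picardLefschetz_oneNodeMonomial_holds` — **it is a theorem** (the port);
* `picardLefschetz_oneNodeMonomial_of_oneNode` — the general-direction fact implies it (instantiation).

Honest scope: the general-direction `picardLefschetz_oneNode` is NOT proved here; nothing here says HC or any rung is proved.

## References

* [VoisinHodgeII2003] C. Voisin, Hodge Theory and Complex Algebraic Geometry II, CUP 2003, §3.2.1 Thm. 3.16, Cor. 3.17, Rem. 3.18,
  Rem. 3.21 and §2.2.2 Cor. 2.17.
* [ArnoldGuseinzadeVarchenko2012] V. I. Arnold, S. M. Gusein-Zade, A. N. Varchenko, Singularities of Differentiable Maps II (2012),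
  Part I §1.3 (Picard–Lefschetz theorem, Lemmas 1.4–1.5), §2.1.
* [Lamotke1981] K. Lamotke, The topology of complex projective varieties after S. Lefschetz, Topology 20 (1981), §6.
-/

noncomputable section

open CategoryTheory AlgebraicGeometry MvPolynomial
open Literature.AlgebraicTopology.SingularHomology
open Literature.AlgebraicGeometry.Motives Literature.AlgebraicGeometry.Motives.UniversalHypersurface

namespace Literature.AlgebraicGeometry.HodgeTheory

section HodgeTheory

/-- **Picard–Lefschetz formula for a ONE-nodal member of the universal family along a MONOMIAL pencil direction, per pencil** (named
fact, keyed instance of `picardLefschetz_oneNode`: the direction is `g = a·xᵢ^d`).  Let `n, d ≥ 1`, `f₁` a form of degree `d` on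
`ℙⁿ⁺¹_ℂ` whose hypersurface has exactly one singular point, an ordinary double point `[p]`, and `i`, `a` with `a pᵢ^d ≠ 0`.  Then there
is `ε₀ > 0` such that (i) `f₁ + c' a xᵢ^d` is nonsingular for `0 < |c'| < ε₀`, and for every cohomological local trivialisation datum
`hU`, every `0 < ε < ε₀`, every point `s'` of `U(ℂ)` with form `f₁ + ε a xᵢ^d` and every loop `γ` at `s'` running once around the
circle `f₁ + ε e^{2πiθ} a xᵢ^d` — and, IF `n` IS EVEN, provided the rational transport of `Rⁿπ_*ℚ` along `γ` is not the identity — there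
are `δ ∈ Hⁿ(Y_{s'}(ℂ); ℚ)` and `c ∈ ℚ` forming Picard–Lefschetz data for `γ` (`IsPicardLefschetzData n d 1 … γ ![δ] c`).
[cite: VoisinHodgeII2003, §3.2.1 Thm. 3.16, Cor. 3.17, Rem. 3.18, Rem. 3.21 and §2.2.2 Cor. 2.17]
[cite: ArnoldGuseinzadeVarchenko2012, Part I §1.3 Picard–Lefschetz theorem with Lemmas 1.4, 1.5]
[cite: Lamotke1981, §6 (the Picard–Lefschetz formulas)] -/
def picardLefschetz_oneNodeMonomial : Prop :=
  ∀ (n d : ℕ) (hn : 1 ≤ n) (hd : 1 ≤ d) (f₁ : MvPolynomial (Fin (n + 2)) ℂ),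
    f₁.IsHomogeneous d →
    ∀ (p : Fin (n + 2) → ℂ), IsNodalFormWithNodes f₁ ![p] →
      ∀ (i : Fin (n + 2)) (a : ℂ), eval p (a • X i ^ d : MvPolynomial (Fin (n + 2)) ℂ) ≠ 0 →
        ∃ ε₀ : ℝ, 0 < ε₀ ∧
          (∀ c' : ℂ, c' ≠ 0 → ‖c'‖ < ε₀ → SmoothHypersurface.IsNonsingularForm ℂ (f₁ + c' • (a • X i ^ d))) ∧
          ∀ (hU : IsCohomologicallyLocallyTrivialOn (family ℂ n d) Set.univ) (ε : ℝ), 0 < ε → ε < ε₀ →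
            ∀ (s' : ComplexPoints (base ℂ n d)), pointForm ℂ n d s' = f₁ + (ε : ℂ) • (a • X i ^ d) →
              ∀ (γ : Path s' s'), IsPencilCircle n d f₁ (a • X i ^ d) ε γ →
                (Even n → ∀ T : bettiCohomology (fiberOver (family ℂ n d) s') n ≃ₗ[ℚ]
                    bettiCohomology (fiberOver (family ℂ n d) s') n,
                  IsRatTransport (family ℂ n d) n hU (loopClassUniv n d γ) T → T ≠ LinearEquiv.refl ℚ _) →
                ∃ (δ : bettiCohomology (fiberOver (family ℂ n d) s') n) (c : ℚ),
                  IsPicardLefschetzData n d 1 hn hd hU γ ![δ] c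

/-- **The monomial-direction one-node Picard–Lefschetz fact is a theorem** (the ODP-ISOTOPY port,
`NodalPencilPicardLefschetz.picardLefschetz_oneNode_monomial`). [cite: VoisinHodgeII2003, §3.2.1 Thm. 3.16 and Cor. 3.17]
[cite: ArnoldGuseinzadeVarchenko2012, Part I §1.3 and §2.1] -/
theorem picardLefschetz_oneNodeMonomial_holds : picardLefschetz_oneNodeMonomial :=
  fun n d hn hd f₁ hf₁ p hp i a hga => NodalPencil.picardLefschetz_oneNode_monomial n d hn hd f₁ hf₁ p hp i a hga

/-- The general-direction fact implies the monomial-direction one (instantiate `g := a • X i ^ d`, homogeneous of degree `d`).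
[cite: VoisinHodgeII2003, §3.2.1 Thm. 3.16] -/
theorem picardLefschetz_oneNodeMonomial_of_oneNode (h : picardLefschetz_oneNode) : picardLefschetz_oneNodeMonomial := by
  intro n d hn hd f₁ hf₁ p hp i a hga
  have hg : (a • X i ^ d : MvPolynomial (Fin (n + 2)) ℂ).IsHomogeneous d := by
    rw [smul_eq_C_mul]
    simpa using ((isHomogeneous_C (Fin (n + 2)) a).mul (isHomogeneous_X_pow (R := ℂ) i d))
  exact h n d hn hd f₁ (a • X i ^ d) hf₁ hg p hp hga

end HodgeTheory

end Literature.AlgebraicGeometry.HodgeTheory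

end
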